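import Summits.HodgeConjecture.HodgeConjecture.Theorems.GenericDivisibilityGenericDivisibilityBoundedLevelCleanFunnel
import Literature.AlgebraicTopology.SingularHomology.RelativeCochains
import HarnessLib

/-!
# Bounded extension defect ⇒ C2 at `X` (crux `GenericDivisibilityBounded`, stmt-HodgeConjecture-18467,
# line `finite-level-bootstrap`): the plug-in point for the crux ideas

Sorry-free, definition-free. For a smooth projective complex `X`, a degree `k` and a proper
Zariski-closed `Z ⊊ X`, write `z| = z|_{(X∖Z)(ℂ)}` and say that the EXTENSION DEFECT of `X` in degree
`k` is bounded by `e` (after shrinking) if: whenever `j • y` (`j ≥ 1`, `y ∈ H^k((X∖Z)(ℂ);ℤ)`) is the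
restriction of a global class, `e • y` is the restriction of a global class on some smaller
non-empty Zariski open. The two first lemmas of the crux ideas `formality-denominators` (k = 1
ideator, `FirstLemmaA` / `BoundedRestrictionTorsion`) and `birational-snc-descent` (k = 2 ideator,
`c2At_of_extensionDefectLe`) are proved here in the vocabulary of the line `finite-level-bootstrap`:

* `genericDivisibilityBounded_extension_of_relTorsionBound` — a bound `e` on the torsion of the
  relative group `H^{k+1}(X(ℂ), (X∖Z)(ℂ); ℤ)` bounds the extension defect along `Z` by `e` (long
  exact sequence of the pair, Hatcher §3.1);
* `genericDivisibilityBounded_levelClean_of_extensionDefect` — extension defect `≤ ℓ^v e'`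
  (`e'` prime to `ℓ`) makes level `ℓ^{v+1}` CLEAN: `D'(ℓ^{v+1}, z) ⇒ z ∈ ℓ H + GT` (Bézout); primed
  version with `v = v_ℓ(e)`;
* `genericDivisibilityBounded_at_of_extensionDefect`, `genericDivisibilityBounded_at_of_relTorsionBound`
  — composed with the funnel (`genericDivisibilityBounded_at_of_levelClean`: bootstrap, Krull,
  `GT ⊗ ℂ ⊆ N¹`): **C2 holds at `X` in degree `k` as soon as one `e ≥ 1` bounds the extension
  defect, in particular as soon as one `e` kills the torsion of `H^{k+1}(X(ℂ),(X∖Z)(ℂ);ℤ)` for every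
  proper Zariski-closed `Z`.** For `k = 2p = dim X ≥ 4` that torsion is, by Alexander–Lefschetz
  duality, the torsion of `H_{2p-1}(Z(ℂ);ℤ)` of divisors `Z` — the object the crux ideas bound.

References: [HatcherAT2002] §3.1 p. 200; [ColliotTheleneVoisin2012] §3–4. -/

set_option linter.dupNamespace false

noncomputable section

namespace Summit.HodgeConjecture.HodgeConjecture.Theorems

open CategoryTheory AlgebraicGeometry
open Literature.AlgebraicGeometry.Motives Literature.AlgebraicGeometry.HodgeTheory
  Literature.AlgebraicTopology.SingularHomology

/-- Restriction `H^k(X(ℂ);ℤ) → H^k((X∖Z)(ℂ);ℤ)`, the very term of the route decls (notation only). -/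
local notation3 (prettyPrint := false) "Res[" X ", " Z ", " k "]" =>
  singularCohomology.map ℤ ℤ
    (⟨Subtype.val, continuous_subtype_val⟩ : C(complexPointsCompl X Z, ComplexPoints X)) k

/-- The inclusion `(X ∖ Z')(ℂ) ↪ (X ∖ Z)(ℂ)` for `h : Z ⊆ Z'`, spelled as in
`genericDivisibility_restrict_restrict` (notation only). -/
local notation3 (prettyPrint := false) "Incl[" X ", " Z ", " Z' ", " h "]" =>
  (⟨fun P : complexPointsCompl X Z' => (⟨P.1, fun hP : P.1.pt ∈ Z => P.2 (h hP)⟩ :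
      complexPointsCompl X Z),
    continuous_subtype_val.subtype_mk fun (P : complexPointsCompl X Z') (hP : P.1.pt ∈ Z) =>
      P.2 (h hP)⟩ : C(complexPointsCompl X Z', complexPointsCompl X Z))

/-! ### Transport through the exact sequence of the pair `(X(ℂ), (X∖Z)(ℂ))` -/

/-- **Bounded torsion in `H^{k+1}(X(ℂ), (X∖Z)(ℂ); ℤ)` bounds the extension defect.** If every
torsion class of the relative group `H^{k+1}(X(ℂ), (X ∖ Z)(ℂ); ℤ)` is killed by `e`, then for every
`y ∈ H^k((X∖Z)(ℂ); ℤ)` with `j • y` (`j ≥ 1`) the restriction of a global class, `e • y` is the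
restriction of a global class: `j • δ y = δ (j • y) = 0`, so `e • δ y = 0 = δ (e • y)` and `e • y ∈
ker δ = im (H^k(X(ℂ)) → H^k((X∖Z)(ℂ)))` (exactness of `H^k(X) → H^k(A) —δ→ H^{k+1}(X, A)`,
Hatcher §3.1 p. 200; here `A = {P ∈ X(ℂ) | P ∉ Z}` IS `(X∖Z)(ℂ)`). [cite: HatcherAT2002, §3.1 p. 200] -/
theorem genericDivisibilityBounded_extension_of_relTorsionBound {X : SchemeOver ℂ} (Z : Set X.left)
    (k e : ℕ)
    (htb : ∀ (c : relSingularCohomology ℤ ℤ (ComplexPoints X) {P : ComplexPoints X | P.pt ∉ Z} (k + 1))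
      (j : ℕ), 1 ≤ j → j • c = 0 → e • c = 0)
    (y : singularCohomology ℤ ℤ (complexPointsCompl X Z) k) (j : ℕ) (hj : 1 ≤ j)
    (hy : ∃ w : singularCohomology ℤ ℤ (ComplexPoints X) k, Res[X, Z, k] w = j • y) :
    ∃ w : singularCohomology ℤ ℤ (ComplexPoints X) k, Res[X, Z, k] w = e • y := by
  set A : Set (ComplexPoints X) := {P | P.pt ∉ Z} with hAdef
  have hex := relSingularCohomology.exact_map_δ (R := ℤ) (M := ℤ) (X := ComplexPoints X) A k (k + 1) rfl
  have h0 : singularCohomology.map ℤ ℤ (subsetIncl A) k ≫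
      relSingularCohomology.δ ℤ ℤ (ComplexPoints X) A k (k + 1) rfl = 0 :=
    (relShortComplex_shortExact ℤ ℤ A).comp_δ k (k + 1) rfl
  rw [ShortComplex.moduleCat_exact_iff] at hex
  -- the statement on the carrier `A` of the pair (definitionally `(X ∖ Z)(ℂ)`)
  have key : ∀ y' : singularCohomology ℤ ℤ (↥A) k,
      (∃ w : singularCohomology ℤ ℤ (ComplexPoints X) k,
        singularCohomology.map ℤ ℤ (subsetIncl A) k w = j • y') →
      ∃ u : singularCohomology ℤ ℤ (ComplexPoints X) k,
        singularCohomology.map ℤ ℤ (subsetIncl A) k u = e • y' := by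
    rintro y' ⟨w, hw⟩
    have hδj : relSingularCohomology.δ ℤ ℤ (ComplexPoints X) A k (k + 1) rfl (j • y') = 0 := by
      rw [← hw, ← ModuleCat.comp_apply, h0]; rfl
    rw [map_nsmul] at hδj
    have hδe : relSingularCohomology.δ ℤ ℤ (ComplexPoints X) A k (k + 1) rfl (e • y') = 0 := by
      rw [map_nsmul]; exact htb _ j hj hδj
    obtain ⟨u, hu⟩ := hex (e • y') hδe
    exact ⟨u, hu⟩
  exact key y hy

/-! ### Bounded extension defect ⇒ a clean level at every prime -/

/-- **Bounded extension defect ⇒ level `ℓ^{v+1}` is clean**, for EVERY `ℓ ≥ 2` and every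
decomposition of the bound as `ℓ^v · e'` with `e'` prime to `ℓ`. Hypothesis ("extension defect
`≤ ℓ^v e'` after shrinking"): whenever `j • y` (`j ≥ 1`) is the restriction of a global class to
`(X∖Z)(ℂ)`, `(ℓ^v e') • y` becomes the restriction of a global class on some smaller non-empty
Zariski open `(X∖Z')(ℂ)`. Conclusion: `D'(ℓ^{v+1}, z) ⇒ z ∈ ℓ H + GT`. Proof: from
`M • (z| - ℓ^{v+1} y) = 0`, `(M ℓ^{v+1}) • y = (M • z)|`; the hypothesis gives `w` with
`w|' = ℓ^v e' • y|'`, so `M • (e' z - ℓ w)|' = 0`, i.e. `e' z - ℓ w ∈ GT`; Bézout `a e' = b ℓ + 1`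
gives `z - ℓ (a w - b z) = a (e' z - ℓ w) ∈ GT`. (First lemma of the crux ideas
`formality-denominators` / `birational-snc-descent`, in the line's vocabulary.) [folklore] -/
theorem genericDivisibilityBounded_levelClean_of_extensionDefect {X : SchemeOver ℂ}
    (k ℓ v e' : ℕ) (hℓ : 2 ≤ ℓ) (hcop : Nat.Coprime e' ℓ)
    (hBTE : ∀ (Z : Set X.left), IsClosed Z → Z ≠ Set.univ →
      ∀ (y : singularCohomology ℤ ℤ (complexPointsCompl X Z) k) (j : ℕ), 1 ≤ j →
        (∃ w : singularCohomology ℤ ℤ (ComplexPoints X) k, Res[X, Z, k] w = j • y) →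
        ∃ (Z' : Set X.left) (h : Z ⊆ Z'), IsClosed Z' ∧ Z' ≠ Set.univ ∧
          ∃ w : singularCohomology ℤ ℤ (ComplexPoints X) k,
            Res[X, Z', k] w = (ℓ ^ v * e') • singularCohomology.map ℤ ℤ Incl[X, Z, Z', h] k y)
    (z : singularCohomology ℤ ℤ (ComplexPoints X) k)
    (hz : ∃ Z : Set X.left, IsClosed Z ∧ Z ≠ Set.univ ∧
      ∃ (y : singularCohomology ℤ ℤ (complexPointsCompl X Z) k) (M : ℕ), 1 ≤ M ∧
        M • (Res[X, Z, k] z - ℓ ^ (v + 1) • y) = 0) :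
    ∃ w : singularCohomology ℤ ℤ (ComplexPoints X) k, ∃ Z : Set X.left, IsClosed Z ∧
      Z ≠ Set.univ ∧ ∃ N : ℕ, 1 ≤ N ∧ N • Res[X, Z, k] (z - ℓ • w) = 0 := by
  obtain ⟨Z, hZ, hZne, y, M, hM, hMz⟩ := hz
  rw [smul_sub, sub_eq_zero, ← mul_smul] at hMz
  -- `(M ℓ^{v+1}) • y` is the restriction of the global class `M • z`
  obtain ⟨Z', hZZ', hZ', hZ'ne, w, hw⟩ := hBTE Z hZ hZne y (M * ℓ ^ (v + 1))
    (Nat.one_le_iff_ne_zero.2 (Nat.mul_ne_zero (by omega) (pow_ne_zero _ (by omega))))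
    ⟨M • z, by rw [map_nsmul, hMz]⟩
  -- transport `M • z| = (M ℓ^{v+1}) • y` to `(X ∖ Z')(ℂ)`
  have hA := congrArg (singularCohomology.map ℤ ℤ Incl[X, Z, Z', hZZ'] k) hMz
  rw [map_nsmul, map_nsmul] at hA
  change M • singularCohomology.map ℤ ℤ _ k (singularCohomology.map ℤ ℤ _ k z) = _ at hA
  rw [genericDivisibility_restrict_restrict ℤ hZZ'] at hA
  -- `e' z - ℓ w ∈ GT`, witnessed on `(X ∖ Z')(ℂ)` with multiplier `M`
  have hGT : ∃ Z₀ : Set X.left, IsClosed Z₀ ∧ Z₀ ≠ Set.univ ∧ ∃ N : ℕ, 1 ≤ N ∧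
      N • Res[X, Z₀, k] (e' • z - ℓ • w) = 0 := by
    refine ⟨Z', hZ', hZ'ne, M, hM, ?_⟩
    rw [map_sub, map_nsmul, map_nsmul, hw, smul_sub, smul_comm M e', hA, sub_eq_zero]
    module
  -- Bézout in `ℕ`: `e' a = ℓ b + 1`
  obtain ⟨a, -, ha⟩ := Nat.exists_mul_mod_eq_one_of_coprime hcop (by omega)
  set b := e' * a / ℓ with hb
  have hab : e' * a = ℓ * b + 1 := by
    have := Nat.div_add_mod (e' * a) ℓ
    rw [ha] at this
    exact this.symm
  refine ⟨a • w - b • z, ?_⟩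
  have hid : z - ℓ • (a • w - b • z) = a • (e' • z - ℓ • w) := by
    have hz1 : z = (e' * a) • z - (ℓ * b) • z := by
      rw [hab, add_smul, one_smul, add_sub_cancel_left]
    nth_rw 1 [hz1]
    module
  rw [hid]
  exact genericDivisibilityBounded_genericallyTorsion_nsmul a hGT

/-- The same with the bound `e ≥ 1` given as a single number: for a PRIME `ℓ`, a bounded extension
defect `e` makes level `ℓ^{v_ℓ(e)+1}` clean (`e = ℓ^{v_ℓ(e)} · e'` with `e'` prime to `ℓ`,
`Nat.ordProj_mul_ordCompl_eq_self`). [folklore] -/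
theorem genericDivisibilityBounded_levelClean_of_extensionDefect' {X : SchemeOver ℂ}
    (k : ℕ) {ℓ e : ℕ} (hℓ : ℓ.Prime) (he : 1 ≤ e)
    (hBTE : ∀ (Z : Set X.left), IsClosed Z → Z ≠ Set.univ →
      ∀ (y : singularCohomology ℤ ℤ (complexPointsCompl X Z) k) (j : ℕ), 1 ≤ j →
        (∃ w : singularCohomology ℤ ℤ (ComplexPoints X) k, Res[X, Z, k] w = j • y) →
        ∃ (Z' : Set X.left) (h : Z ⊆ Z'), IsClosed Z' ∧ Z' ≠ Set.univ ∧
          ∃ w : singularCohomology ℤ ℤ (ComplexPoints X) k,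
            Res[X, Z', k] w = e • singularCohomology.map ℤ ℤ Incl[X, Z, Z', h] k y)
    (z : singularCohomology ℤ ℤ (ComplexPoints X) k)
    (hz : ∃ Z : Set X.left, IsClosed Z ∧ Z ≠ Set.univ ∧
      ∃ (y : singularCohomology ℤ ℤ (complexPointsCompl X Z) k) (M : ℕ), 1 ≤ M ∧
        M • (Res[X, Z, k] z - ℓ ^ (e.factorization ℓ + 1) • y) = 0) :
    ∃ w : singularCohomology ℤ ℤ (ComplexPoints X) k, ∃ Z : Set X.left, IsClosed Z ∧
      Z ≠ Set.univ ∧ ∃ N : ℕ, 1 ≤ N ∧ N • Res[X, Z, k] (z - ℓ • w) = 0 := by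
  have hdec : ℓ ^ e.factorization ℓ * (e / ℓ ^ e.factorization ℓ) = e :=
    Nat.ordProj_mul_ordCompl_eq_self e ℓ
  have hcop : Nat.Coprime (e / ℓ ^ e.factorization ℓ) ℓ :=
    (Nat.coprime_ordCompl hℓ (by omega)).symm
  refine genericDivisibilityBounded_levelClean_of_extensionDefect k ℓ (e.factorization ℓ)
    (e / ℓ ^ e.factorization ℓ) hℓ.two_le hcop ?_ z hz
  rw [hdec]
  exact hBTE

/-! ### The two reductions composed with the funnel: C2 at `X` -/

/-- **C2 at `X` from a bounded extension defect** (any smooth projective `X`, any degree `k`):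
if some `e ≥ 1` bounds the extension defect after shrinking (hypothesis as in
`genericDivisibilityBounded_levelClean_of_extensionDefect'`), then every `z ∈ H^k(X(ℂ);ℤ)` divisible
by every `m ≥ 1` on non-empty Zariski opens has complexification in `supportedClasses X k 1`
(level `2^{v₂(e)+1}` is clean at the prime `2`; then the funnel
`genericDivisibilityBounded_at_of_levelClean`). [folklore] -/
theorem genericDivisibilityBounded_at_of_extensionDefect {n₀ : ℕ} {X : SchemeOver ℂ}
    (hX : IsSmoothProjective n₀ X) (k : ℕ) {e : ℕ} (he : 1 ≤ e)
    (hBTE : ∀ (Z : Set X.left), IsClosed Z → Z ≠ Set.univ →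
      ∀ (y : singularCohomology ℤ ℤ (complexPointsCompl X Z) k) (j : ℕ), 1 ≤ j →
        (∃ w : singularCohomology ℤ ℤ (ComplexPoints X) k, Res[X, Z, k] w = j • y) →
        ∃ (Z' : Set X.left) (h : Z ⊆ Z'), IsClosed Z' ∧ Z' ≠ Set.univ ∧
          ∃ w : singularCohomology ℤ ℤ (ComplexPoints X) k,
            Res[X, Z', k] w = e • singularCohomology.map ℤ ℤ Incl[X, Z, Z', h] k y)
    (z : singularCohomology ℤ ℤ (ComplexPoints X) k)
    (hz : ∀ m : ℕ, 1 ≤ m → ∃ Z : Set X.left, IsClosed Z ∧ Z ≠ Set.univ ∧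
      ∃ y : singularCohomology ℤ ℤ (complexPointsCompl X Z) k, m • y = Res[X, Z, k] z) :
    singularCohomology.ringChange (Int.castRingHom ℂ) (ComplexPoints X) k z ∈
      supportedClasses X k 1 :=
  genericDivisibilityBounded_at_of_levelClean hX k Nat.prime_two (Nat.le_add_left 1 _)
    (fun z' hz' ↦ genericDivisibilityBounded_levelClean_of_extensionDefect' k Nat.prime_two he hBTE
      z' hz') z hz

/-- **C2 at `X` from a uniform torsion bound on the relative groups `H^{k+1}(X(ℂ),(X∖Z)(ℂ);ℤ)`**:
if one `e ≥ 1` kills the torsion of `H^{k+1}(X(ℂ), (X∖Z)(ℂ); ℤ)` for EVERY proper Zariski-closed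
`Z`, then C2 holds at `X` in degree `k` (the extension defect is then `≤ e` without shrinking:
`genericDivisibilityBounded_extension_of_relTorsionBound`). For `k = 2` on a surface and `e = 1`
this is the route of the landed surface case; for `k = 2p ≥ 4` the hypothesis is the
"bounded restriction torsion" statement of the crux ideas, by Alexander–Lefschetz duality a bound on
the torsion of `ker (H_{2p-1}(Z(ℂ);ℤ) → H_{2p-1}(X(ℂ);ℤ))` over all divisors `Z`. [folklore] -/
theorem genericDivisibilityBounded_at_of_relTorsionBound {n₀ : ℕ} {X : SchemeOver ℂ}
    (hX : IsSmoothProjective n₀ X) (k : ℕ) {e : ℕ} (he : 1 ≤ e)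
    (htb : ∀ (Z : Set X.left), IsClosed Z → Z ≠ Set.univ →
      ∀ (c : relSingularCohomology ℤ ℤ (ComplexPoints X) {P : ComplexPoints X | P.pt ∉ Z} (k + 1))
        (j : ℕ), 1 ≤ j → j • c = 0 → e • c = 0)
    (z : singularCohomology ℤ ℤ (ComplexPoints X) k)
    (hz : ∀ m : ℕ, 1 ≤ m → ∃ Z : Set X.left, IsClosed Z ∧ Z ≠ Set.univ ∧
      ∃ y : singularCohomology ℤ ℤ (complexPointsCompl X Z) k, m • y = Res[X, Z, k] z) :
    singularCohomology.ringChange (Int.castRingHom ℂ) (ComplexPoints X) k z ∈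
      supportedClasses X k 1 := by
  refine genericDivisibilityBounded_at_of_extensionDefect hX k he (fun Z hZ hZne y j hj hy ↦ ?_) z hz
  obtain ⟨w, hw⟩ :=
    genericDivisibilityBounded_extension_of_relTorsionBound Z k e (htb Z hZ hZne) y j hj hy
  refine ⟨Z, subset_refl Z, hZ, hZne, w, ?_⟩
  have hid : singularCohomology.map ℤ ℤ Incl[X, Z, Z, subset_refl Z] k y = y := by
    have h1 : (Incl[X, Z, Z, subset_refl Z]) = ContinuousMap.id (complexPointsCompl X Z) := rfl
    rw [h1, singularCohomology.map_id]
    rfl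
  rw [hw, hid]


/-- **Registered sub-goal `stub_cruxAtOfRelTorsionBound` of stmt-HodgeConjecture-18467: the crux at
`X` (any degree `k`) from ONE bound `e` on the torsion of the relative groups
`H^{k+1}(X(ℂ), (X∖Z)(ℂ); ℤ)` over all proper Zariski-closed `Z`** — verbatim
`genericDivisibilityBounded_at_of_relTorsionBound`. [folklore] -/
theorem stub_cruxAtOfRelTorsionBound :
    ∀ ⦃n₀ : ℕ⦄ ⦃X : SchemeOver ℂ⦄, IsSmoothProjective n₀ X → ∀ (k e : ℕ), 1 ≤ e →
      (∀ (Z : Set X.left), IsClosed Z → Z ≠ Set.univ →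
        ∀ (c : relSingularCohomology ℤ ℤ (ComplexPoints X) {P : ComplexPoints X | P.pt ∉ Z} (k + 1))
          (j : ℕ), 1 ≤ j → j • c = 0 → e • c = 0) →
      ∀ z : singularCohomology ℤ ℤ (ComplexPoints X) k,
        (∀ m : ℕ, 1 ≤ m → ∃ Z : Set X.left, IsClosed Z ∧ Z ≠ Set.univ ∧
          ∃ y : singularCohomology ℤ ℤ (complexPointsCompl X Z) k,
            m • y = singularCohomology.map ℤ ℤ
              (⟨Subtype.val, continuous_subtype_val⟩ : C(complexPointsCompl X Z, ComplexPoints X))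
              k z) →
        singularCohomology.ringChange (Int.castRingHom ℂ) (ComplexPoints X) k z ∈
          supportedClasses X k 1 :=
  fun _ _ hX k _ he htb z hz ↦ genericDivisibilityBounded_at_of_relTorsionBound hX k he htb z hz

end Summit.HodgeConjecture.HodgeConjecture.Theorems

end
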